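/-
Copyright: statement-level skeleton of a published paper (lit-balaban cell, Phase-2 proof seat p25, gen 19). No proof
claims beyond what the kernel checks below.
-/
import Literature.MathematicalPhysics.QuantumFieldTheory.BalabanImbrieJaffe1984to88.BIJ88WalkExpansion311

/-!
# `BalabanImbrieJaffe1984to88.BIJ88WalkRemainderRecords312` — T. Bałaban, J. Imbrie, A. Jaffe, *Effective action and
cluster properties of the abelian Higgs model*, Commun. Math. Phys. **114** (1988) 257–315 [BalabanImbrieJaffe1988],
§5.14 p. 311 [PDF 55], verbatim: *"A connected component of X is called complete if a contraction to χ′_{Λ^{(k)}}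
occurs, if a term from the random walk expansion occurs, if at least m̄+1 interactions have been differentiated
down, or if the term is constant (all legs contracted). We stop integrating by parts fields in complete components of
X."*, *"The components containing contractions to χ′_{Λ^{(k)}}, terms from the random walk expansions, or at least m̄+1
interactions are called remainder components {X_r}."* — **THE RECORDS OF THE REMAINDER COMPONENTS** (p25 gen 19; the
bookkeeping the remainder-side small factors are read from): along the covariance-split expansion of p25 gen 18
(`BIJ88WalkRun311.run`, `BIJ88WalkExpansion311.expand`) (i) the random-walk count of every component IS the number of
triggering pieces among its recorded pieces (`run_nw`, `expand_nw`), (ii) the `χ′`-directions of a term are exactly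
as many as the `χ′`-contractions recorded in its components (`run_nchi`, `expand_nchi`, `expand_dirs_length_init`),
(iii) every component set aside at the end of the expansion of a product of observables is a REMAINDER component in
the printed sense — a `χ′`-contraction, or at least `M = m̄+1` vertices, or a random-walk term (`expand_groups_isRem_init`;
gen 18's `expand_sound_init` recorded only "complete").  No estimates here; the three records are turned into the three
small factors in the sequel `BIJ88WalkRemainderShape312`.

statement-level skeleton of published theorems with citation tags; proofs where landed; nothing here is a claim
about the Yang–Mills mass gap

PDF held: `paper:balaban1988-cmp114-bij-abelian-higgs-effective-action` (journal page = PDF page + 256); p. 311 =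
PDF 55 (`p0055.txt` L29–38 re-read this session, 2026-08-23).

CITATION HEADER (lean-in-tree rule).  lit-balaban cell (HOME `run/shared/lean/pub/lit-balaban/`), Phase 2, seat p25
gen 19; row **C2.Claim@312** of `HOME/lit-balaban-r16/ROWS-C2-part2.md` (owner r16, referee ref-5; head
`BIJ88Sect5StatementsPart4.Ineq312` untouched — MEMBER of the row, bookkeeping).  USED BY NAME, nothing restated:
`BIJ88WalkRun311.{WGrp, WOut, run, pristine, WGrp.IsConst, WGrp.IsRem, WGrp.absorb, WGrp.isConst_or_isRem_of_complete}`,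
`BIJ88WalkRunEnv311.{run_ind', run_rest_subset, run_done_le}`, `BIJ88WalkExpansion311.{WTerm, oact, expand,
expand_of_nonempty, expand_of_not_nonempty, expand_sound_init}` (p25 gen 18), `BIJ88LabelledRun311.mem_mbind` (p25 gen 16).

## What is proved (0 `sorry`, standard axioms, no new `Prop` facts; theorems only)

* §1 **`run_nw`**, **`expand_nw`**, `expand_nw_init`: `X.nw = #{p ∈ X.pcs : trig p}` for every block and every
  remainder component.
* §2 **`run_nchi`** (`|D_o| + g.nchi + Σ_{done} nchi = o.g.nchi + Σ_{o.done} nchi`), **`expand_nchi`**,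
  `expand_dirs_length_init` (`|dirs t| = Σ_{X ∈ t.groups} X.nchi` for the terms of `expand 0 K`).
* §3 `expand_groups_not_isConst`, **`expand_groups_isRem_init`** (every set-aside component of a term of `expand 0 K`
  is a remainder component).
HONEST SCOPE: bookkeeping identities only (contraction-graph components, fixed order of events, as in gen 18); no
estimates; no `Ineq312` binder.  NOT summit progress; NOT continuum; NOT Clay.  Imports `BIJ88WalkExpansion311`;
modifies nothing.
-/

noncomputable section

namespace Literature.MathematicalPhysics.QuantumFieldTheory.BalabanImbrieJaffe1984to88.BIJ88WalkRemainderRecords312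

open Classical Matrix Finset
open scoped BigOperators
open BIJ88LabelledRun311 (mbind mem_mbind)
open BIJ88WalkRun311 BIJ88WalkRunEnv311 BIJ88WalkExpansion311

variable {S : Type} [Fintype S] {ι : Type} [Fintype ι] {κ : Type} [LinearOrder κ] {P : Type} [Fintype P]

variable {Cov : P → Matrix S S ℝ} {trig : P → Bool} {f : S → ℝ} {c : ι → ℝ} {legs : ι → List (S → ℝ)}
  {obs : κ → List (S → ℝ)} {M : ℕ}

/-! ## §1  The random-walk count is the number of triggering pieces recorded -/

omit [Fintype P] in
/-- Recording a piece adds `trig p` to the count of triggering pieces (bookkeeping). [folklore] -/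
private theorem countP_cons_toNat (trig : P → Bool) (p : P) (m : Multiset P) :
    (p ::ₘ m).countP (fun q => trig q = true) = m.countP (fun q => trig q = true) + (trig p).toNat := by
  rw [Multiset.countP_cons]
  cases trig p <;> simp

/-- **The random-walk count of a component is the number of triggering pieces among its records, along a run**
(every event records the piece `p` and adds `trig p`; an absorbed component brings its pieces and its count).
[cite: BalabanImbrieJaffe1988, §5.14 p.311] -/
theorem run_nw (g : WGrp S κ ι P) (rest : Finset κ) (done : Multiset (WGrp S κ ι P)) :
    ∀ o ∈ run Cov trig f c legs obs M g rest done,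
      g.nw = g.pcs.countP (fun q => trig q = true) →
        (∀ h ∈ done, h.nw = h.pcs.countP (fun q => trig q = true)) →
          o.g.nw = o.g.pcs.countP (fun q => trig q = true) ∧
            ∀ h ∈ o.done, h.nw = h.pcs.countP (fun q => trig q = true) := by
  refine run_ind' (Q := fun g _ done o => g.nw = g.pcs.countP (fun q => trig q = true) →
      (∀ h ∈ done, h.nw = h.pcs.countP (fun q => trig q = true)) →
        o.g.nw = o.g.pcs.countP (fun q => trig q = true) ∧
          ∀ h ∈ o.done, h.nw = h.pcs.countP (fun q => trig q = true))
    (fun _ _ _ _ hg hd => ⟨hg, hd⟩) ?_ ?_ ?_ ?_ ?_ ?_ g rest done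
  · intro g rest done u L p _ _ i o _ IH hg hd
    exact IH (show g.nw + (trig p).toNat = (p ::ₘ g.pcs).countP (fun q => trig q = true) by
      rw [countP_cons_toNat, hg]) hd
  · intro g rest done u L p _ _ j _ i o _ IH hg hd
    exact IH (show g.nw + (trig p).toNat = (p ::ₘ g.pcs).countP (fun q => trig q = true) by
      rw [countP_cons_toNat, hg]) hd
  · intro g rest done u L p _ _ h hh i _ o _ IH hg hd
    refine IH ?_ (fun h' hh' => hd h' (Multiset.mem_of_le (Multiset.erase_le _ _) hh'))
    show g.nw + h.nw + (trig p).toNat = (p ::ₘ (g.pcs + h.pcs)).countP (fun q => trig q = true)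
    rw [countP_cons_toNat, Multiset.countP_add, hg, hd h hh]
  · intro g rest done u L p _ _ o _ IH hg hd
    exact IH (show g.nw + (trig p).toNat = (p ::ₘ g.pcs).countP (fun q => trig q = true) by
      rw [countP_cons_toNat, hg]) hd
  · intro g rest done u L p _ _ o _ IH hg hd
    exact IH (show g.nw + (trig p).toNat = (p ::ₘ g.pcs).countP (fun q => trig q = true) by
      rw [countP_cons_toNat, hg]) hd
  · intro g rest done u L p _ _ m j o _ IH hg hd
    exact IH (show g.nw + (trig p).toNat = (p ::ₘ g.pcs).countP (fun q => trig q = true) by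
      rw [countP_cons_toNat, hg]) hd

omit [Fintype S] [Fintype ι] [LinearOrder κ] [Fintype P] in
/-- A pristine observable has no piece and no random-walk term. [cite: BalabanImbrieJaffe1988, §5.14 p.311] -/
theorem pristine_nw (j : κ) :
    (pristine (ι := ι) (P := P) obs j).nw = (pristine (ι := ι) (P := P) obs j).pcs.countP (fun q => trig q = true) := by
  simp [pristine]

/-- **… and along the whole expansion**: every block and every set-aside component of every term of
`expand done rest` has `nw = #{triggering pieces recorded}`, given this for `done`. [cite: BalabanImbrieJaffe1988, §5.14 p.311] -/
theorem expand_nw : ∀ (n : ℕ) (done : Multiset (WGrp S κ ι P)) (rest : Finset κ), rest.card < n →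
    (∀ h ∈ done, h.nw = h.pcs.countP (fun q => trig q = true)) → ∀ t ∈ expand Cov trig f c legs obs M done rest,
      ∀ X ∈ t.consts + t.groups, X.nw = X.pcs.countP (fun q => trig q = true)
  | 0, _, _, hn => fun _ _ _ => absurd hn (Nat.not_lt_zero _)
  | n + 1, done, rest, hn => by
    intro hd t ht
    by_cases h : rest.Nonempty
    · rw [expand_of_nonempty Cov trig f c legs obs M h, mem_mbind] at ht
      obtain ⟨o, ho, ht⟩ := ht
      have hcard : o.rest.card < n := lt_of_lt_of_le (lt_of_le_of_lt (Finset.card_le_card (run_rest_subset _ _ _ o ho))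
        (Finset.card_erase_lt_of_mem (rest.min'_mem h))) (Nat.lt_succ_iff.1 hn)
      obtain ⟨hog, hod⟩ := run_nw _ _ _ o ho (pristine_nw (rest.min' h)) hd
      split_ifs at ht with hg
      · rw [Multiset.mem_map] at ht
        obtain ⟨t', ht', rfl⟩ := ht
        have ih := expand_nw n o.done o.rest hcard hod t' ht'
        intro X hX
        simp only [WTerm.addConst_consts, WTerm.addConst_groups, oact_consts, oact_groups, Multiset.cons_add,
          Multiset.mem_cons] at hX
        rcases hX with rfl | hX
        · exact hog
        · exact ih X hX
      · rw [Multiset.mem_map] at ht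
        obtain ⟨t', ht', rfl⟩ := ht
        have hd' : ∀ h' ∈ o.g ::ₘ o.done, h'.nw = h'.pcs.countP (fun q => trig q = true) := fun h' hh' => by
          rcases Multiset.mem_cons.1 hh' with rfl | hh'
          · exact hog
          · exact hod h' hh'
        have ih := expand_nw n _ o.rest hcard hd' t' ht'
        intro X hX
        simp only [oact_consts, oact_groups] at hX
        exact ih X hX
    · rw [expand_of_not_nonempty Cov trig f c legs obs M h, Multiset.mem_singleton] at ht
      subst ht
      intro X hX
      change X ∈ (0 : Multiset (WGrp S κ ι P)) + done at hX
      rw [zero_add] at hX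
      exact hd X hX

/-- **Corollary** (nothing set aside): for the terms of `expand 0 K`, every component's random-walk count is the
number of its triggering pieces. [cite: BalabanImbrieJaffe1988, §5.14 p.311] -/
theorem expand_nw_init (K : Finset κ) : ∀ t ∈ expand Cov trig f c legs obs M 0 K,
    ∀ X ∈ t.consts + t.groups, X.nw = X.pcs.countP (fun q => trig q = true) :=
  expand_nw _ 0 K (Nat.lt_succ_self _) (fun _ hh => absurd hh (Multiset.notMem_zero _))

/-! ## §2  The `χ′`-directions of a term are the `χ′`-contractions recorded in its components -/

/-- **`χ′` bookkeeping along a run**: the directions produced in the run plus the `χ′`-counts at the start equal the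
`χ′`-counts of the outcome's component and set-aside components (a contraction to `χ′` adds one direction and one to
the count; an absorbed component brings its count). [cite: BalabanImbrieJaffe1988, §5.14 p.311] -/
theorem run_nchi (g : WGrp S κ ι P) (rest : Finset κ) (done : Multiset (WGrp S κ ι P)) :
    ∀ o ∈ run Cov trig f c legs obs M g rest done,
      o.D.length + g.nchi + (done.map WGrp.nchi).sum = o.g.nchi + (o.done.map WGrp.nchi).sum := by
  refine run_ind' (Q := fun g _ done o =>
      o.D.length + g.nchi + (done.map WGrp.nchi).sum = o.g.nchi + (o.done.map WGrp.nchi).sum)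
    (fun _ _ _ _ => by simp) ?_ ?_ ?_ ?_ ?_ ?_ g rest done
  · intro g rest done u L p _ _ i o _ h; exact h
  · intro g rest done u L p _ _ j _ i o _ h; exact h
  · intro g rest done u L p _ _ h hh i _ o _ h'
    have e : (done.map WGrp.nchi).sum = h.nchi + ((done.erase h).map WGrp.nchi).sum := by
      conv_lhs => rw [← Multiset.cons_erase hh]
      rw [Multiset.map_cons, Multiset.sum_cons]
    have h2 : o.D.length + (g.nchi + h.nchi) + ((done.erase h).map WGrp.nchi).sum
        = o.g.nchi + (o.done.map WGrp.nchi).sum := h'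
    change o.D.length + g.nchi + (done.map WGrp.nchi).sum = o.g.nchi + (o.done.map WGrp.nchi).sum
    rw [e]
    omega
  · intro g rest done u L p _ _ o _ h; exact h
  · intro g rest done u L p _ _ o _ h
    have h2 : o.D.length + (g.nchi + 1) + (done.map WGrp.nchi).sum = o.g.nchi + (o.done.map WGrp.nchi).sum := h
    change (Cov p *ᵥ u :: o.D).length + g.nchi + (done.map WGrp.nchi).sum = o.g.nchi + (o.done.map WGrp.nchi).sum
    rw [List.length_cons]
    omega
  · intro g rest done u L p _ _ m j o _ h; exact h

/-- **`χ′` bookkeeping along the expansion**: `|dirs t| + Σ_{h ∈ done} h.nchi = Σ_{X ∈ t.consts + t.groups} X.nchi` for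
every term of `expand done rest`. [cite: BalabanImbrieJaffe1988, §5.14 p.311] -/
theorem expand_nchi : ∀ (n : ℕ) (done : Multiset (WGrp S κ ι P)) (rest : Finset κ), rest.card < n →
    ∀ t ∈ expand Cov trig f c legs obs M done rest,
      t.dirs.length + (done.map WGrp.nchi).sum = ((t.consts + t.groups).map WGrp.nchi).sum
  | 0, _, _, hn => fun _ _ => absurd hn (Nat.not_lt_zero _)
  | n + 1, done, rest, hn => by
    intro t ht
    by_cases h : rest.Nonempty
    · rw [expand_of_nonempty Cov trig f c legs obs M h, mem_mbind] at ht
      obtain ⟨o, ho, ht⟩ := ht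
      have hcard : o.rest.card < n := lt_of_lt_of_le (lt_of_le_of_lt (Finset.card_le_card (run_rest_subset _ _ _ o ho))
        (Finset.card_erase_lt_of_mem (rest.min'_mem h))) (Nat.lt_succ_iff.1 hn)
      have hrun := run_nchi _ _ _ o ho
      have hpr : (pristine (ι := ι) (P := P) obs (rest.min' h)).nchi = 0 := rfl
      rw [hpr, add_zero] at hrun
      split_ifs at ht with hg
      · rw [Multiset.mem_map] at ht
        obtain ⟨t', ht', rfl⟩ := ht
        have ih := expand_nchi n o.done o.rest hcard t' ht'
        have h0 : o.g.nchi = 0 := hg.2.1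
        change (o.D ++ t'.dirs).length + (done.map WGrp.nchi).sum
          = (((o.g ::ₘ t'.consts) + t'.groups).map WGrp.nchi).sum
        rw [List.length_append, Multiset.cons_add, Multiset.map_cons, Multiset.sum_cons, ← ih, h0]
        omega
      · rw [Multiset.mem_map] at ht
        obtain ⟨t', ht', rfl⟩ := ht
        have ih := expand_nchi n (o.g ::ₘ o.done) o.rest hcard t' ht'
        rw [Multiset.map_cons, Multiset.sum_cons] at ih
        change (o.D ++ t'.dirs).length + (done.map WGrp.nchi).sum = ((t'.consts + t'.groups).map WGrp.nchi).sum
        rw [List.length_append, ← ih]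
        omega
    · rw [expand_of_not_nonempty Cov trig f c legs obs M h, Multiset.mem_singleton] at ht
      subst ht
      simp

/-- **Corollary** (nothing set aside): a term of `expand 0 K` has exactly as many `χ′`-directions as its REMAINDER
components record `χ′`-contractions (blocks record none). [cite: BalabanImbrieJaffe1988, §5.14 p.311] -/
theorem expand_dirs_length_init (K : Finset κ) : ∀ t ∈ expand Cov trig f c legs obs M 0 K,
    t.dirs.length = (t.groups.map WGrp.nchi).sum := by
  intro t ht
  have h := expand_nchi (Cov := Cov) (trig := trig) (f := f) (c := c) (legs := legs) (obs := obs) (M := M) _ 0 K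
    (Nat.lt_succ_self _) t ht
  have hc : (t.consts.map WGrp.nchi).sum = 0 := Multiset.sum_eq_zero fun x hx => by
    obtain ⟨g, hg, rfl⟩ := Multiset.mem_map.1 hx
    exact ((expand_sound_init K t ht).1 g hg).2.1
  simpa [Multiset.map_add, Multiset.sum_add, hc] using h

/-! ## §3  The set-aside components are remainder components -/

/-- **Nothing constant is ever set aside**: if no component of `done` is constant, no set-aside component of any term
of `expand done rest` is (a constant component is booked as a block; set-aside components are only passed on).
[cite: BalabanImbrieJaffe1988, §5.14 p.311–312] -/
theorem expand_groups_not_isConst : ∀ (n : ℕ) (done : Multiset (WGrp S κ ι P)) (rest : Finset κ), rest.card < n →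
    (∀ h ∈ done, ¬ h.IsConst M) → ∀ t ∈ expand Cov trig f c legs obs M done rest, ∀ X ∈ t.groups, ¬ X.IsConst M
  | 0, _, _, hn => fun _ _ _ => absurd hn (Nat.not_lt_zero _)
  | n + 1, done, rest, hn => by
    intro hd t ht
    by_cases h : rest.Nonempty
    · rw [expand_of_nonempty Cov trig f c legs obs M h, mem_mbind] at ht
      obtain ⟨o, ho, ht⟩ := ht
      have hcard : o.rest.card < n := lt_of_lt_of_le (lt_of_le_of_lt (Finset.card_le_card (run_rest_subset _ _ _ o ho))
        (Finset.card_erase_lt_of_mem (rest.min'_mem h))) (Nat.lt_succ_iff.1 hn)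
      have hod : ∀ h' ∈ o.done, ¬ h'.IsConst M := fun h' hh' =>
        hd h' (Multiset.mem_of_le (run_done_le _ _ _ o ho) hh')
      split_ifs at ht with hg
      · rw [Multiset.mem_map] at ht
        obtain ⟨t', ht', rfl⟩ := ht
        have ih := expand_groups_not_isConst n o.done o.rest hcard hod t' ht'
        intro X hX
        simp only [WTerm.addConst_groups, oact_groups] at hX
        exact ih X hX
      · rw [Multiset.mem_map] at ht
        obtain ⟨t', ht', rfl⟩ := ht
        have hd' : ∀ h' ∈ o.g ::ₘ o.done, ¬ h'.IsConst M := fun h' hh' => by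
          rcases Multiset.mem_cons.1 hh' with rfl | hh'
          · exact hg
          · exact hod h' hh'
        have ih := expand_groups_not_isConst n _ o.rest hcard hd' t' ht'
        intro X hX
        simp only [oact_groups] at hX
        exact ih X hX
    · rw [expand_of_not_nonempty Cov trig f c legs obs M h, Multiset.mem_singleton] at ht
      subst ht
      exact hd

/-- **EVERY SET-ASIDE COMPONENT OF THE EXPANSION OF A PRODUCT OF OBSERVABLES IS A REMAINDER COMPONENT** (p. 311
*"The components containing contractions to χ′, terms from the random walk expansions, or at least m̄+1 interactions
are called remainder components {X_r}"*): `0 < X.nchi ∨ M ≤ #X.vxs ∨ 0 < X.nw` for every `X ∈ t.groups`,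
`t ∈ expand 0 K`. [cite: BalabanImbrieJaffe1988, §5.14 p.311] -/
theorem expand_groups_isRem_init (K : Finset κ) : ∀ t ∈ expand Cov trig f c legs obs M 0 K,
    ∀ X ∈ t.groups, X.IsRem M := fun t ht X hX =>
  (WGrp.isConst_or_isRem_of_complete ((expand_sound_init K t ht).2 X hX)).resolve_left
    (expand_groups_not_isConst (Cov := Cov) (trig := trig) (f := f) (c := c) (legs := legs) (obs := obs) _ 0 K
      (Nat.lt_succ_self _) (fun _ hh => absurd hh (Multiset.notMem_zero _)) t ht X hX)

end Literature.MathematicalPhysics.QuantumFieldTheory.BalabanImbrieJaffe1984to88.BIJ88WalkRemainderRecords312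

end
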